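import Literature.NumberTheory.Automorphic.HyperspecialUnitarySatakeIsomorphismAdicCompletion
import HarnessLib

/-!
# The unramified eigencharacters `λ_β` of `ℋ(U(σ, J₀), K₀)` are invariant under the Weyl group acting on the Satake parameter
# (every rank; Cartier 1979 §IV Cor. 4.2)

Topic `NumberTheory/Automorphic`; namespaces `Literature.NumberTheory.Automorphic[.HermitianLattice.UnramifiedLocalConjDatum | .UnitaryGroup]`
(lane `lit-hodgefound`, Track 2 foundations; seat `lit-hodgefound-p11`, generation 48, row g48-#13).  THEOREMS ONLY: no definition,
no named fact, no instance, no notation.  Successor pointer (ii) of generation 47 («the `S_n`-part of the `W`-invariance of `λ_β`»,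
the tree had `λ_{β⁻¹} = λ_β` only): with `heckeEigencharacter_eq_of_exists_perm` (g48-#10) the full statement is immediate.

## The mathematics

For `π ∈ W = C_{S_N}(rev)` and `β ∈ (ℂˣ)^N`: `(β ∘ π)^μ = ∏ β_{π i}^{μ_i} = β^{μ ∘ π⁻¹}`, and `π⁻¹ ∈ W`; hence
**`λ_{β ∘ π} = λ_β`** for every `T ∈ ℋ(U(σ, J₀^{(N)}), K₀)` (`σ ≠ id`, finite residue field), locally and at the inert unramified
places of a quadratic extension of number fields. [cite: CartierCorvallis1979, §IV Cor. 4.2] [cite: Minguez2011, §4]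

## What is formalised

* `laurentMonomialHom_comp_perm` (`(β ∘ π)^μ = β^{μ ∘ π⁻¹}`), **`heckeEigencharacter_comp_perm`** (`λ_{β∘π} = λ_β`, `π ∈ W`),
  **`unitaryHeckeEigencharacterAdic_comp_perm`** (the same at the inert unramified places).
-/

noncomputable section

open scoped Valued WithZero Matrix MatrixGroups
open MonoidAlgebra Representation NumberField IsDedekindDomain

namespace Literature.NumberTheory.Automorphic

/-- **`(β ∘ π)^μ = β^{μ ∘ π⁻¹}`** for a coordinate permutation `π`. [cite: CartierCorvallis1979, §IV Cor. 4.2] -/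
theorem laurentMonomialHom_comp_perm {N : ℕ} (β : Fin N → ℂˣ) (π : Equiv.Perm (Fin N)) (μ : Fin N → ℤ) :
    laurentMonomialHom (fun i => β (π i)) (Multiplicative.ofAdd μ) = laurentMonomialHom β (Multiplicative.ofAdd (μ ∘ ⇑π⁻¹)) := by
  change (((∏ i, β (π i) ^ μ i : ℂˣ)) : ℂ) = (((∏ i, β i ^ (μ ∘ ⇑π⁻¹) i : ℂˣ)) : ℂ)
  congr 1
  exact Fintype.prod_equiv π (fun i => β (π i) ^ μ i) (fun j => β j ^ (μ ∘ ⇑π⁻¹) j) fun i => by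
    simp only [Function.comp_apply, Equiv.Perm.inv_def, Equiv.symm_apply_apply]

namespace HermitianLattice.UnramifiedLocalConjDatum

open Literature.NumberTheory.Automorphic.HermitianLattice

variable {K : Type*} [Field K] [Valued K ℤᵐ⁰] {σ : K →+* K} {ϖ : K} {N : ℕ}

/-- **`λ_{β ∘ π} = λ_β` FOR EVERY `π` IN THE WEYL GROUP `C_{S_N}(rev)`** (every `N`; `σ ≠ id`, finite residue field): the unramified
eigencharacters of `ℋ(U(σ, J₀^{(N)}), K₀)` only see the `W`-orbit of the Satake parameter. [cite: CartierCorvallis1979, §IV Cor. 4.2]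
[cite: Minguez2011, §4] -/
theorem heckeEigencharacter_comp_perm (hd : UnramifiedLocalConjDatum σ ϖ) [Finite 𝓀[K]] (hσ : ∃ x : K, σ x ≠ x) (β : Fin N → ℂˣ)
    {π : Equiv.Perm (Fin N)} (hπ : ∀ i, π (Fin.rev i) = Fin.rev (π i)) :
    hd.heckeEigencharacter (fun i => β (π i)) = hd.heckeEigencharacter β :=
  hd.heckeEigencharacter_eq_of_exists_perm hσ (perm_inv_rev hπ) fun μ _ => laurentMonomialHom_comp_perm β π μ

end HermitianLattice.UnramifiedLocalConjDatum

namespace UnitaryGroup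

open Literature.NumberTheory.Automorphic.HermitianLattice

variable {F E : Type} [Field F] [NumberField F] [Field E] [NumberField E] [Algebra F E] [Algebra.IsQuadraticExtension F E]
  (c : E ≃ₐ[F] E) (hc1 : c ≠ 1) (v : HeightOneSpectrum (𝓞 F)) (w : PlacesOver E v) (hw : c • w.1 = w.1)
  (hv : Algebra.IsUnramifiedIn (𝓞 E) v.asIdeal) {N : ℕ}
include hc1 hv

/-- **`λ_{β ∘ π} = λ_β` at every inert unramified place**, `π ∈ C_{S_N}(rev)` (every `N`). [cite: CartierCorvallis1979, §IV Cor. 4.2]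
[cite: Minguez2011, §4] -/
theorem unitaryHeckeEigencharacterAdic_comp_perm (β : Fin N → ℂˣ) {π : Equiv.Perm (Fin N)}
    (hπ : ∀ i, π (Fin.rev i) = Fin.rev (π i)) :
    unitaryHeckeEigencharacterAdic c hc1 v w hw hv (fun i => β (π i)) = unitaryHeckeEigencharacterAdic c hc1 v w hw hv β := by
  haveI := finite_residueField_adicCompletion E w.1
  exact (unramifiedLocalConjDatum_localConjUniformizer c hc1 v w hw hv).heckeEigencharacter_comp_perm
    (exists_galAdicCompletionMap_ne c hc1 v w hw) β hπ

end UnitaryGroup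

end Literature.NumberTheory.Automorphic

end
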